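import Mathlib

/-!
# Telescoping duals for the `plane-iv0` certificate format — the edge-term lemma

Seat `hubbard-upper-certfmt-1` (cell sr-mbsolver, crew (3) hubbard-upper; format file
`HOME/hubbard-upper-certfmt-1/FORMAT-plane-iv0.md` §4 (G″) (P-DUAL), v0.5). HONEST FRAMING: first certified bounds;
not a superconductivity verdict; generic real-analysis lemmas (no statement about the Hubbard model's numbers).
Companion of `Summits/Ventures/CertifiedManyBodySolver/Upper/PlaneConeIneq.lean` (range / transport / (P-TRIM) /
(P-NEST) / (P-GAUGE) / Cesàro lemmas).

A TELESCOPING DUAL adds `Φ(z) - z` to a cone group, `z` a bounded operator on the virtual chain and `Φ` one column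
step. By the transport identity `Tr[ρ_j Φ(z)] = Tr[ρ_{j+1} z]` (`PlaneConeIneq.coneTransport_trace`) the dualled
group's value on slice `j` is `e j + (f (j+1) - f j)` with `f j := Tr[ρ_j z]`, `|f| ≤ ‖z‖`; summed over the columns of
a box the correction telescopes to a boundary term. So duals tighten the per-slice cone bounds at ZERO cost in cone
dimension and cost only an `A`-independent edge constant:

* `abs_sum_telescope_le` : `|f| ≤ B` gives `|Σ_{j<A} (f (j+1) - f j)| ≤ 2B`;
* `sum_le_of_dual_bound` : if every slice obeys the dualled bound `e j + (f (j+1) - f j) ≤ λ`, then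
  `Σ_{j<A} e j ≤ A·λ + 2B`.
-/

open Finset

namespace Summit.Ventures.CertifiedManyBodySolver.Upper.PlaneTelescopingDual

/-- **(P-DUAL) telescoping duals — the boundary term.** If `|f i| ≤ B` for all `i` (in the format: `f j = Tr[ρ_j z]`
for a bounded dual operator `z` on the virtual chain, `B = ‖z‖`), then the telescoping sum over the `A` columns of a
box is an EDGE term: `|Σ_{j<A} (f (j+1) - f j)| ≤ 2B`, independent of `A`. -/
theorem abs_sum_telescope_le (f : ℕ → ℝ) {B : ℝ} (hB : ∀ i, |f i| ≤ B) (A : ℕ) :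
    |∑ j ∈ Finset.range A, (f (j + 1) - f j)| ≤ 2 * B := by
  rw [Finset.sum_range_sub]
  have h1 := hB A
  have h0 := hB 0
  calc |f A - f 0| ≤ |f A| + |f 0| := abs_sub _ _
    _ ≤ B + B := add_le_add h1 h0
    _ = 2 * B := by ring

/-- **(P-DUAL) soundness in the Cesàro step (FORMAT v0.5 §4 (G″)).** A telescoping dual adds
`Φ(z) - z` to a cone group: by the transport identity `Tr[ρ_j Φ(z)] = Tr[ρ_{j+1} z]` the value of the DUALLED
group on slice `j` is `e j + (f (j+1) - f j)` with `f j := Tr[ρ_j z]`. If every slice of the box obeys the dualled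
cone bound `e j + (f (j+1) - f j) ≤ λ` and `|f| ≤ B`, then the plain column sum still obeys
`Σ_{j<A} e j ≤ A·λ + 2B`: duals move value between neighbouring slices and cost only an `A`-independent edge term. -/
theorem sum_le_of_dual_bound (e f : ℕ → ℝ) {B lam : ℝ} (hB : ∀ i, |f i| ≤ B) (A : ℕ)
    (hcone : ∀ j, j < A → e j + (f (j + 1) - f j) ≤ lam) :
    ∑ j ∈ Finset.range A, e j ≤ A * lam + 2 * B := by
  have hsum : ∑ j ∈ Finset.range A, (e j + (f (j + 1) - f j)) ≤ ∑ j ∈ Finset.range A, lam :=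
    Finset.sum_le_sum fun j hj => hcone j (Finset.mem_range.1 hj)
  rw [Finset.sum_add_distrib, Finset.sum_const, Finset.card_range, nsmul_eq_mul] at hsum
  have htel := abs_sum_telescope_le f hB A
  have hlow : -(2 * B) ≤ ∑ j ∈ Finset.range A, (f (j + 1) - f j) := (abs_le.1 htel).1
  linarith

/-- **Lower end.** Symmetrically, if every slice obeys `lam ≤ e j + (f (j+1) - f j)` then
`A·lam - 2B ≤ Σ_{j<A} e j` (the diagnostic lower enclosure `c⁻` with duals). -/
theorem dual_bound_le_sum (e f : ℕ → ℝ) {B lam : ℝ} (hB : ∀ i, |f i| ≤ B) (A : ℕ)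
    (hcone : ∀ j, j < A → lam ≤ e j + (f (j + 1) - f j)) :
    A * lam - 2 * B ≤ ∑ j ∈ Finset.range A, e j := by
  have hsum : ∑ j ∈ Finset.range A, lam ≤ ∑ j ∈ Finset.range A, (e j + (f (j + 1) - f j)) :=
    Finset.sum_le_sum fun j hj => hcone j (Finset.mem_range.1 hj)
  rw [Finset.sum_add_distrib, Finset.sum_const, Finset.card_range, nsmul_eq_mul] at hsum
  have htel := abs_sum_telescope_le f hB A
  have hup : ∑ j ∈ Finset.range A, (f (j + 1) - f j) ≤ 2 * B := (abs_le.1 htel).2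
  linarith

end Summit.Ventures.CertifiedManyBodySolver.Upper.PlaneTelescopingDual
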